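import Mathlib
import HarnessLib
import Summits.ABC.Statement
import Summits.ABC.ABC.Theses.RootDecompJ

/-!
# PlatonicClosureTransport — part 1/5 of the node file `PlatonicClosure` (door J, second layer; lens-1 gen 7)

Source: lens-1 g7 `PlatonicClosure.lean` v2.1 (cell `decomp-abc`; sha256 `05826916bf38e332…`; lens + critic + writer
`lean check` rc 0, 0 sorry, axioms standard; critic CLEARED decomp-abc STATUS l.470 / l.479 / l.490).

This module: §0 types · §1 Platonic levels / cells / `AbcOn` · §2 `abc_of_transport` (the transport principle) · §3
arithmetic helpers.

Landing form (prover lane, writer asks (d)/(d′), ladder-directors REQUESTS l.59623 / l.59667): the 1643-line source is split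
MECHANICALLY into five Theorems modules of ≤ 400 lines — `PlatonicClosureTransport` (§0–§3) → `PlatonicClosureOctahedral`
(§4–§5) → `PlatonicClosureCloses` (§6–§7b) → `PlatonicClosure` (§8–§10, head module of door J's node) →
`PlatonicClosureKummerDoors` (§11–§12b, the only module importing doors B/G).  The ONLY edits: namespace
`Summit.ABC.ABC.Theorems.PlatonicClosure` (source: `…Theses.PlatonicClosure`) with `open Summit.ABC.ABC.Theses` so that
`RootDecompJ.…` / `RootDecompB.…` / `RootDecompG.…` denote the TREE decls exactly as in the source, one-line docstrings on the
declarations that had none, per-module imports and module docstrings.  Every statement and every proof is byte-identical to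
the source, except that six folklore radical / symmetry lemmas already landed elsewhere in the tree (gate `dedup.landed`) are
`private` here, with private verbatim copies in the later modules that use them.  Nothing here proves `ABC` or any item of
doors J/B/G: all five files are `--supports` helpers (node construction).

## The source's module docstring (verbatim)

# PlatonicClosure — second layer of door J: the Platonic levels of the spherical residual (lens-1, gen 7)

Cell `decomp-abc`, seat lens-1 («exponent / quality ladder»), generation 7.  Door J (`Theses/RootDecompJ.lean`, born from
this seat's gen-6 node) decomposes `ABC ⟸ P_H ∧ P_E ∧ P_S` by the orbifold Euler characteristic of the powerfulness profile
(hyperbolic / Euclidean / spherical admissible multiplicities).  Its residual `P_S = SphericalABC` carries almost all abc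
triples.  This node asks the next question BY CONSTRUCTION rather than by population: **which sub-cells of the spherical
cell can carry the summit, and which cannot?**  The instrument is new in the cell: QUALITY-PRESERVING TRANSPORTS — binary-form
identities `F + G = H` coming from the Belyi maps of the finite rotation groups (power map `C_N`, dihedral `D_N`, Klein's
octahedral syzygy; Klein, *Lectures on the Icosahedron* I §§11–13 [galaxy:panama:275427662757932 p.80 `108t⁴ - W³ + χ² = 0`,
p.82 `T² = -H³ + 1728f⁵`]) having THREE RATIONAL SPECIAL POINTS.  Such a transport maps every abc triple `(a,b,c)` to an abc
triple `(a',b',c')` of prescribed powerfulness profile with `c^{k+1} ≤ A·c'` and `rad(a'b'c') ≤ K·rad(abc)·cᵏ` — the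
Riemann–Hurwitz count `#(special fibres) = deg + 2` leaves forms of total degree `deg - 1` outside `{a, b, a±b}`, so exactly one
power of `c` is lost against `deg` powers gained (the Mason/Belyi equality case, Bombieri–Gubler Thm 12.4.1 + Rem 12.4.2
[corpus:bombieri2006 p.412]; the Elkies–Langevin direction `abc ⟹ …` runs these maps forwards [corpus:bombieri2006 pp.394–399]).
Run BACKWARDS, a transport LOADS its target cell: `abc` on (target cell ∪ Hyp ∪ Euc) implies `ABC` with arbitrarily small
exponent loss (`abc_of_transport`, §2: `N`-fold exponent bookkeeping, the only real-analysis step).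

## The node (exact: `closes7`, `node_iff7`)

    ABC ⟸ P_H ∧ P_E ∧ P_I ∧ P_O,      P_S DECORATIVE (`sphericalABC_of_pieces`)

* `P_H = RootDecompJ.CampanaHyperbolicBound` [stmt-ABC-29353, W — gen 6], `P_E = RootDecompJ.EuclideanABC` [29354, W — gen 6]: door J's
  items BY NAME (this file imports the born route file; `campanaHyperbolicBound_iff`, `euclideanABC_iff`, `sphericalABC_iff` are `Iff.rfl`).
* **`P_I = IcosahedralABC`** (NEW): abc on the ICOSAHEDRAL CELL `IcoCell` = spherical triples whose powerfulness profile is exactly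
  `(2,3,5)` up to order (a squareful, a cube-full and a 5-full member; `10² + 3⁵ = 7³`, kernel witness `icoCell_100_243_343`;
  infinite: it contains the coprime solutions of `x² + y³ = z⁵`, Beukers 1998 [graph:doi:10.1215/s0012-7094-98-09105-0],
  Edwards 2004 [graph:doi:10.1515/crll.2004.043]; population `≍ B^{1/30}`).  TAG: **UNDECIDED, with stated test `T_ico`** (below).
* **`P_O = OctahedralABC`** (NEW): abc on the OCTAHEDRAL CELL `OctCell` = profile exactly `(2,3,4)` up to order (population `≍ B^{1/12}`;
  kernel witness `octCell_octaImage`: `4879² + 108·30⁴ = 481³`, the octahedral image of `1 + 1 = 2`).  TAG: **DECLARED RESIDUAL**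
  (`≡ S` modulo `P_H, P_E, P_I`: `abc_iff_octahedral`; loaded by the kernel transport `octa_core`).
* The rest of door J's residual — the spherical BULK below the octahedral level (profiles `(≤1,q,r)`, `(2,2,n)`, `(2,3,3)`; essentially
  all `≍ B^{2/3}` abc triples) — is NOT an item: it is implied (`sphericalABC_of_pieces`).  The residual of the door has been moved from
  a co-large cell onto a cell of population `B^{1/12}`, not by declaring a thin set (critic: «T4 population splits are free») but by a
  kernel theorem that the thin set receives a quality-preserving image of every abc triple.

## Closure audit of the spherical cell (what is COSTUME by construction, what is not)

Symmetric spherical LEVELS (upward-closed in the profile): `Λ_N` two members `N`-full · `Δ_N` all members squareful and one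
`N`-full · `T = L₂₃₃` · `O = L₂₃₄` · `I = L₂₃₅`.  KERNEL: `Λ_N` is loaded for every `N` (`pow_transport`, `deloc`, §7: power map,
profile `(N,·,N)`); `Δ_N` is loaded for every `N` (`dihedral_core`, `dihedral_loaded`, §7b: `(xᴺ+yᴺ)² = (xᴺ-yᴺ)² + 4(xy)ᴺ`, profile
`(2,N,2)`); `T ⊇ O` are loaded (`octa_core`, `closes7`, §§4,6: Klein `t² + 108f⁴ = H³`, profile `(2,4,3)`).  Consequently EVERY statement
"abc on (a symmetric spherical level other than `I`) ∪ Hyp ∪ Euc" is `≡ S` — recorded so that no lens files them as WEAKER — and the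
door-J residual DELOCALISES: `ABC ⟺ P_H ∧ P_E ∧ abc|PowCell N` for every `N` (`node_iff_pow`), along NESTED supports of population
`≍ B^{2/N}` with EMPTY intersection (`powCell_nested`, `powCell_evanescent`) — the formal content of «thinness is free».
PAPER (negative half, not kernel): NO transport of the Riemann–Hurwitz-minimal degree 60 loads `I`: a degree-60 Belyi map with
ramification floors `(2,3,5)` is Klein's icosahedral Galois map, and no `ℚ`-model of it has three rational points in the special
fibres (a rational vertex or face point forces a `μ₅`-twist with at most two rational special points; the edge model obtained by
Hilbert 90 from `κ² = (-3-4i)/5` has exactly two; a rational pair of face points is impossible since `u⁴ - 228u³ + 494u² + 228u + 1`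
is irreducible over `ℚ`).  **TEST `T_ico`** (decides the tag of `P_I`): does there exist a Belyi map `β ∈ ℚ(t)` of degree `d > 60`
whose ramification indices over `0, 1, ∞` are all at least `2, 3, 5` respectively (floors, up to order) and with at least three
`ℚ`-rational points in `β⁻¹{0,1,∞}`?  YES ⟹ `P_I ≡ S` (COSTUME, by the same `abc_of_transport`); NO for all `d` ⟹ `P_I` is immune to
the entire transport class, i.e. a candidate GENUINELY WEAKER piece (it is implied by abc restricted to the 27 Edwards–Klein
parametrizing forms of degree 60: an `abc`-for-binary-forms statement à la Langevin, itself open).  Either answer is informative;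
each Riemann–Hurwitz-feasible degree `d ≥ 66` (`d + 2 ≤ ⌊d/2⌋ + ⌊d/3⌋ + ⌊d/5⌋`: 66, 70, 72, 75, 76, …) is a finite passport search (leaf
INSTRUMENTABLE; not run here: kit not allowed in this seat).  At `d = 60` the floors force exact indices and the map is the orbifold universal
cover of `S²/A₅`, i.e. Klein's — whence the lemma.

## Tags (critic grammar)
`P_H` W(gen-6 evidence: orbifold Mordell for hyperbolic C-pairs, ≠ S by bc2/bc7; census HYP = 19 members ≤ 10¹⁸) · `P_E` W(gen 6) ·
`P_I` UNDECIDED(test `T_ico`; bc2 probe `P_I → ABC` FAILS; bc7 CLEAN) · `P_O` DECLARED RESIDUAL (kernel `≡ S` mod the others; bc7 CLEAN) ·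
`P_S` DECORATIVE (kernel) · every other symmetric spherical level-piece: COSTUME (kernel transports, this file).
Leaves: `P_I` IDEA-NEEDED/INSTRUMENTABLE (`T_ico` passport search; Langevin-for-27-forms), `P_O` BARRIER-free residual (ATTACKABLE only
as S), `P_H` children (gen-6 pkg, HELD), `P_E` ATTACKABLE (Pell/unit-equation cell, gen 6).

## v2 addendum (cycle 2, identity-side BLOCKER; §§0–10 byte-identical to v1 = sha256 2f71cc41…, critic CLEARED l.470)
§11 FLOOR BLOCKER: «two members N-full» in ANY two positions, WITHOUT thin pieces, carries S for every N ≥ 1 (`abc_iff_fullAC'`,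
`abc_iff_fullBC'`, `abc_iff_fullAB'` — the last by the odd power-sum lift `(aᴹ, bᴹ, aᴹ+bᴹ)`, third rational special point t = −1);
`floor_blocker` (any cell containing one of them is ≡ S); `dichotomy_localises` (every door's cut Q/¬Q is carried by its trace on
`FullAC N`).  §12 over the TREE decls of the Kummer doors B and G (imports RootDecompB/G): `abc_iff_powAC` (two EXACT N-th powers),
`doorB_without_low : KummerFloorHigh → KummerFloorCell5 → ABC` (B's `KummerFloorLow` stmt-ABC-25299 is DECORATIVE), `doorB_localised`
(B's residual matters only on `PowAC 5`: abc for `x⁵ + b = z⁵` with large 5-free radical of `b`), `doorG_localised` /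
`doorG_without_lowfloor` (G's floor needed only on `PowAC 4`: `KummerFloor4High`); §12b ATOMS in the critic's blocker grammar v0 (II):
`doorB_atom`, `doorG_atom` (shape `Floor_R → (AbcOn (R ∧ P_θ) ↔ AbcOn R)`), `profile_atom` (shape `∀ θ, ABC ↔ AbcOn P_θ`), and lens-1's
share of the honesty clause (III) `OpenGrammarsLens1`.

## Contents
§0 types · §1 Platonic levels/cells · §2 `abc_of_transport` · §3 helpers · §4 `octa_core` (Klein octahedral transport, frame lemma
`exists_frame`) · §5 items `IcosahedralABC`, `OctahedralABC` (inline texts) + `Iff.rfl` bridges · §6 `closes7`, `sphericalABC_of_pieces`,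
`abc_iff_octahedral` · §7 power lift, `deloc`, `node_iff_pow`, nested/evanescent · §7b dihedral lift · §8 witnesses · §9 necessity
`S ⟹ P_H` (gen-6 copy) · §10 `node_iff7` · §11 floor blocker · §12 Kummer doors B/G localised.  `lean check`: rc 0 · 0 sorry · 0 error (bc/audit7.json); probes bc/bc2_mustfail (9/9 FAIL as
required), bc/bc7_probe.out (2/2 CLEAN).  No `instance`, no `notation`, no `allowUnsafeReducibility`; IUT not cited.
-/

set_option linter.dupNamespace false
-- lint debt, justified: verbatim planner-cleared proofs keep the item texts' binder names (some hypotheses are unused by name).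
set_option linter.unusedVariables false

open Literature.NumberTheory.DiophantineGeometry
open UniqueFactorizationMonoid
open Finset
-- the route decls of doors J / B / G are referred to as `RootDecompJ.…`, `RootDecompB.…`, `RootDecompG.…` (TREE decls, by name)
open Summit.ABC.ABC.Theses

namespace Summit.ABC.ABC.Theorems.PlatonicClosure

/-! ## §0  Admissible multiplicities, weights, Campana types (as in door J / gen 6) -/

/-- `Adm p x`: multiplicity `p` is admissible at the member `x` (`x` is `p`-full; `p = 0` encodes `∞`, only at `x = 1`). -/
def Adm (p x : ℕ) : Prop := (p = 0 → x = 1) ∧ ∀ ℓ ∈ x.primeFactors, p ≤ x.factorization ℓ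

/-- The weight `1/p + 1/q + 1/r ∈ ℚ` (`0⁻¹ = 0` encodes `1/∞ = 0`). -/
def wt (p q r : ℕ) : ℚ := (p : ℚ)⁻¹ + (q : ℚ)⁻¹ + (r : ℚ)⁻¹

/-- Hyperbolic type: `(a,b,c)` admits a signature `(p,q,r)` (`Adm`) of weight `1/p + 1/q + 1/r < 1`. -/
def HypType (a b c : ℕ) : Prop := ∃ p q r : ℕ, Adm p a ∧ Adm q b ∧ Adm r c ∧ wt p q r < 1
/-- Euclidean shape: `(a,b,c)` admits a signature `(p,q,r)` of weight exactly `1`. -/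
def EucShape (a b c : ℕ) : Prop := ∃ p q r : ℕ, Adm p a ∧ Adm q b ∧ Adm r c ∧ wt p q r = 1
/-- Spherical type: every admissible signature `(p,q,r)` of `(a,b,c)` has weight `> 1`. -/
def SphType (a b c : ℕ) : Prop := ∀ p q r : ℕ, Adm p a → Adm q b → Adm r c → 1 < wt p q r

/-- Trichotomy: every triple is of hyperbolic type, of Euclidean shape, or of spherical type. -/
theorem hyp_or_euc_or_sph (a b c : ℕ) : HypType a b c ∨ EucShape a b c ∨ SphType a b c := by
  by_cases hH : HypType a b c
  · exact Or.inl hH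
  by_cases hE : EucShape a b c
  · exact Or.inr (Or.inl hE)
  refine Or.inr (Or.inr fun p q r hp hq hr => ?_)
  rcases lt_trichotomy (wt p q r) 1 with h | h | h
  · exact absurd ⟨p, q, r, hp, hq, hr, h⟩ hH
  · exact absurd ⟨p, q, r, hp, hq, hr, h⟩ hE
  · exact h

/-! ## §1  Platonic levels inside the spherical cell

Within `SphType` the sorted admissible signatures are `(1,q,r)`, `(2,2,n)`, `(2,3,3)`, `(2,3,4)`, `(2,3,5)`.
`OctSig`/`IcoSig` say, order-free: all three multiplicities `≥ 2`, two of them `≥ 3`, one of them `≥ 4` (resp. `≥ 5`);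
inside `SphType` this pins the sorted signature to `{(2,3,4),(2,3,5)}` (resp. `(2,3,5)`). -/

/-- order-free "(2,3,4) or deeper": all `≥ 2`, two `≥ 3`, one `≥ 4`. -/
def OctSig (p q r : ℕ) : Prop :=
  2 ≤ p ∧ 2 ≤ q ∧ 2 ≤ r ∧ (3 ≤ p ∧ 3 ≤ q ∨ 3 ≤ q ∧ 3 ≤ r ∨ 3 ≤ r ∧ 3 ≤ p) ∧ (4 ≤ p ∨ 4 ≤ q ∨ 4 ≤ r)

/-- order-free "(2,3,5)": all `≥ 2`, two `≥ 3`, one `≥ 5`. -/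
def IcoSig (p q r : ℕ) : Prop :=
  2 ≤ p ∧ 2 ≤ q ∧ 2 ≤ r ∧ (3 ≤ p ∧ 3 ≤ q ∨ 3 ≤ q ∧ 3 ≤ r ∨ 3 ≤ r ∧ 3 ≤ p) ∧ (5 ≤ p ∨ 5 ≤ q ∨ 5 ≤ r)

/-- the octahedral level `L₂₃₄`: some admissible signature is `(2,3,4)` or deeper. -/
def Lvl234 (a b c : ℕ) : Prop := ∃ p q r : ℕ, Adm p a ∧ Adm q b ∧ Adm r c ∧ OctSig p q r
/-- the icosahedral level `L₂₃₅`. -/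
def Lvl235 (a b c : ℕ) : Prop := ∃ p q r : ℕ, Adm p a ∧ Adm q b ∧ Adm r c ∧ IcoSig p q r

/-- ICOSAHEDRAL CELL: spherical triples admitting `(2,3,5)` in some order (profile exactly `(2,3,5)`). -/
def IcoCell (a b c : ℕ) : Prop := SphType a b c ∧ Lvl235 a b c
/-- OCTAHEDRAL CELL: spherical triples admitting `(2,3,4)` in some order but not `(2,3,5)` (profile exactly `(2,3,4)`). -/
def OctCell (a b c : ℕ) : Prop := SphType a b c ∧ Lvl234 a b c ∧ ¬ Lvl235 a b c
/-- the spherical BULK below the octahedral level. -/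
def Bulk (a b c : ℕ) : Prop := SphType a b c ∧ ¬ Lvl234 a b c

/-- abc, `ε`-uniform, on a class `Q` of triples. -/
def AbcOn (Q : ℕ → ℕ → ℕ → Prop) : Prop :=
  ∀ ε : ℝ, 0 < ε → ∃ C : ℝ, 0 < C ∧ ∀ a b c : ℕ, IsABCTriple a b c → Q a b c →
    (c : ℝ) < C * ((rad a b c : ℕ) : ℝ) ^ (1 + ε)

/-- `AbcOn` is antitone in the cell: abc on `Q` gives abc on every `P ⊆ Q`. -/
theorem abcOn_mono {P Q : ℕ → ℕ → ℕ → Prop} (hPQ : ∀ a b c, P a b c → Q a b c) (h : AbcOn Q) : AbcOn P := by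
  intro ε hε
  obtain ⟨C, hC, hQ⟩ := h ε hε
  exact ⟨C, hC, fun a b c ht hP => hQ a b c ht (hPQ a b c hP)⟩

/-- abc on `P` and abc on `Q` give abc on `P ∪ Q`. -/
theorem abcOn_or {P Q : ℕ → ℕ → ℕ → Prop} (hP : AbcOn P) (hQ : AbcOn Q) :
    AbcOn (fun a b c => P a b c ∨ Q a b c) := by
  intro ε hε
  obtain ⟨C₁, hC₁, h₁⟩ := hP ε hε
  obtain ⟨C₂, hC₂, h₂⟩ := hQ ε hε
  refine ⟨max C₁ C₂, lt_max_of_lt_left hC₁, fun a b c ht h => ?_⟩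
  have hR0 : (0 : ℝ) ≤ ((rad a b c : ℕ) : ℝ) ^ (1 + ε) := by positivity
  rcases h with h | h
  · exact (h₁ a b c ht h).trans_le (mul_le_mul_of_nonneg_right (le_max_left _ _) hR0)
  · exact (h₂ a b c ht h).trans_le (mul_le_mul_of_nonneg_right (le_max_right _ _) hR0)

/-- abc on the trivial cell (all triples) is the summit statement `ABC`. -/
theorem abcOn_all_iff : AbcOn (fun _ _ _ => True) ↔ _root_.ABC := by
  rw [_root_.ABC_iff]
  constructor
  · intro h ε hε
    obtain ⟨C, hC, hb⟩ := h ε hε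
    exact ⟨C, hC, fun a b c ht => hb a b c ht trivial⟩
  · intro h ε hε
    obtain ⟨C, hC, hb⟩ := h ε hε
    exact ⟨C, hC, fun a b c ht _ => hb a b c ht⟩

/-- `ABC` gives abc on every cell. -/
theorem abcOn_of_abc (h : _root_.ABC) (Q : ℕ → ℕ → ℕ → Prop) : AbcOn Q :=
  abcOn_mono (fun _ _ _ _ => trivial) (abcOn_all_iff.2 h)

/-- The radical `rad a b c` is positive. -/
private theorem rad_pos' (a b c : ℕ) : 0 < rad a b c := by
  rw [rad_def]; exact Nat.radical_pos _

/-- A class with BOUNDED `c` satisfies abc (`c ≤ B < (B+1)·rad^{1+ε}`). -/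
theorem abcOn_of_bounded {Q : ℕ → ℕ → ℕ → Prop} {B : ℕ} (h : ∀ a b c, IsABCTriple a b c → Q a b c → c ≤ B) :
    AbcOn Q := by
  intro ε hε
  refine ⟨(B : ℝ) + 1, by positivity, fun a b c ht hq => ?_⟩
  have hR1 : (1 : ℝ) ≤ ((rad a b c : ℕ) : ℝ) ^ (1 + ε) :=
    Real.one_le_rpow (by exact_mod_cast rad_pos' a b c) (by linarith)
  have hc : (c : ℝ) ≤ B := by exact_mod_cast h a b c ht hq
  calc (c : ℝ) < (B : ℝ) + 1 := by linarith
    _ ≤ ((B : ℝ) + 1) * ((rad a b c : ℕ) : ℝ) ^ (1 + ε) := le_mul_of_one_le_right (by positivity) hR1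

/-! ## §2  The transport principle (the only real-analysis step)

If every abc triple `(a,b,c)` has an image triple in `Q` with `c^{k+1} ≤ A·c'` and `rad' ≤ K·rad·c^k`
(a BELYI TRANSPORT with three rational special points: gain of exactly one power of `c`), then `AbcOn Q ⟹ ABC`. -/
/-- **Transport principle.** If abc holds on `Q` and every abc triple `(a,b,c)` has an abc image `(a',b',c')` in `Q` with
`c^(k+1) ≤ A·c'` and `rad a' b' c' ≤ K · rad a b c · c^k`, then `ABC`. -/
theorem abc_of_transport {Q : ℕ → ℕ → ℕ → Prop} (hQ : AbcOn Q) {k A K : ℕ} (hA : 0 < A) (hK : 0 < K)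
    (hT : ∀ a b c : ℕ, IsABCTriple a b c → ∃ a' b' c' : ℕ, IsABCTriple a' b' c' ∧ Q a' b' c' ∧
      c ^ (k + 1) ≤ A * c' ∧ rad a' b' c' ≤ K * rad a b c * c ^ k) : _root_.ABC := by
  rw [_root_.ABC_iff]
  intro ε₀ hε₀
  -- choose N with k < N and (N+1)/(N-k) ≤ 1 + ε₀
  obtain ⟨n, hn0, hnε⟩ : ∃ n : ℕ, 0 < n ∧ ((k : ℝ) + 1) ≤ ε₀ * n := by
    refine ⟨⌈((k : ℝ) + 1) / ε₀⌉₊ + 1, by positivity, ?_⟩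
    have h1 : ((k : ℝ) + 1) / ε₀ ≤ ⌈((k : ℝ) + 1) / ε₀⌉₊ := Nat.le_ceil _
    have h3 : ((k : ℝ) + 1) / ε₀ * ε₀ = (k : ℝ) + 1 := div_mul_cancel₀ _ hε₀.ne'
    have h4 := mul_le_mul_of_nonneg_right h1 hε₀.le
    rw [h3] at h4
    push_cast
    nlinarith
  set N : ℕ := n + k with hN
  have hN0 : 0 < N := by omega
  have hNpos : (0 : ℝ) < N := by exact_mod_cast hN0
  obtain ⟨C, hC, hb⟩ := hQ ((N : ℝ)⁻¹) (by positivity)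
  -- the constant
  set M : ℝ := (A : ℝ) ^ N * C ^ N * (K : ℝ) ^ (N + 1) with hM
  have hM0 : 0 < M := by positivity
  set M₁ : ℝ := max M 1 with hM₁
  have hM₁1 : 1 ≤ M₁ := le_max_right _ _
  have hMM₁ : M ≤ M₁ := le_max_left _ _
  refine ⟨M₁ ^ ((n : ℝ)⁻¹), by positivity, fun a b c ht => ?_⟩
  obtain ⟨a', b', c', ht', hq', hcc', hrad'⟩ := hT a b c ht
  have hspec := hb a' b' c' ht' hq'
  -- notation
  set R : ℝ := ((rad a b c : ℕ) : ℝ) with hR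
  set R' : ℝ := ((rad a' b' c' : ℕ) : ℝ) with hR'
  have hR1 : (1 : ℝ) ≤ R := by rw [hR]; exact_mod_cast Nat.one_le_iff_ne_zero.mpr (rad_pos' a b c).ne'
  have hR0 : (0 : ℝ) ≤ R := by positivity
  have hR'0 : (0 : ℝ) ≤ R' := by positivity
  have hc0' : 0 < c := by obtain ⟨ha, -, habc, -⟩ := ht; omega
  have hc0 : (0 : ℝ) < c := by exact_mod_cast hc0'
  -- (1) c^{N(k+1)} ≤ A^N c'^N
  have h1 : (c : ℝ) ^ (N * (k + 1)) ≤ (A : ℝ) ^ N * (c' : ℝ) ^ N := by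
    have : ((c : ℝ) ^ (k + 1)) ^ N ≤ ((A : ℝ) * c') ^ N :=
      pow_le_pow_left₀ (by positivity) (by exact_mod_cast hcc') N
    rwa [← pow_mul, mul_pow, mul_comm (k + 1)] at this
  -- (2) c'^N < C^N R'^{N+1}
  have h2 : (c' : ℝ) ^ N < C ^ N * R' ^ (N + 1) := by
    have hlt : (c' : ℝ) < C * R' ^ (1 + (N : ℝ)⁻¹) := hspec
    have hNne : (N : ℝ) ≠ 0 := hNpos.ne'
    have hpow : (R' ^ (1 + (N : ℝ)⁻¹)) ^ N = R' ^ (N + 1) := by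
      rw [← Real.rpow_natCast (R' ^ (1 + (N : ℝ)⁻¹)) N, ← Real.rpow_mul hR'0, ← Real.rpow_natCast R' (N + 1),
        add_mul, one_mul, inv_mul_cancel₀ hNne]
      push_cast; ring_nf
    have := pow_lt_pow_left₀ hlt (by positivity) hN0.ne'
    rwa [mul_pow, hpow] at this
  -- (3) R'^{N+1} ≤ K^{N+1} R^{N+1} c^{k(N+1)}
  have h3 : R' ^ (N + 1) ≤ (K : ℝ) ^ (N + 1) * R ^ (N + 1) * (c : ℝ) ^ (k * (N + 1)) := by
    have : R' ≤ (K : ℝ) * R * (c : ℝ) ^ k := by rw [hR', hR]; exact_mod_cast hrad'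
    have := pow_le_pow_left₀ hR'0 this (N + 1)
    rwa [mul_pow, mul_pow, ← pow_mul] at this
  -- combine: c^{N(k+1)} < M R^{N+1} c^{k(N+1)}
  have h4 : (c : ℝ) ^ (N * (k + 1)) < M * R ^ (N + 1) * (c : ℝ) ^ (k * (N + 1)) := by
    calc (c : ℝ) ^ (N * (k + 1)) ≤ (A : ℝ) ^ N * (c' : ℝ) ^ N := h1
      _ < (A : ℝ) ^ N * (C ^ N * R' ^ (N + 1)) := mul_lt_mul_of_pos_left h2 (by positivity)
      _ ≤ (A : ℝ) ^ N * (C ^ N * ((K : ℝ) ^ (N + 1) * R ^ (N + 1) * (c : ℝ) ^ (k * (N + 1)))) :=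
          mul_le_mul_of_nonneg_left (mul_le_mul_of_nonneg_left h3 (by positivity)) (by positivity)
      _ = M * R ^ (N + 1) * (c : ℝ) ^ (k * (N + 1)) := by rw [hM]; ring
  -- cancel c^{k(N+1)} : N(k+1) = k(N+1) + n
  have h5 : (c : ℝ) ^ n < M * R ^ (N + 1) := by
    have hsplit : (c : ℝ) ^ (N * (k + 1)) = (c : ℝ) ^ n * (c : ℝ) ^ (k * (N + 1)) := by
      rw [← pow_add]; congr 1; rw [hN]; ring
    rw [hsplit] at h4
    exact lt_of_mul_lt_mul_right h4 (by positivity)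
  -- take n-th roots: c < M₁^{1/n} R^{(N+1)/n}
  have h6 : (c : ℝ) ^ n < (M₁ ^ ((n : ℝ)⁻¹) * R ^ (((N : ℝ) + 1) / n)) ^ n := by
    have hn0' : (n : ℝ) ≠ 0 := by exact_mod_cast hn0.ne'
    have hcast : ((N : ℝ) + 1) = ((N + 1 : ℕ) : ℝ) := by push_cast; ring
    rw [mul_pow, Real.rpow_inv_natCast_pow (by positivity) hn0.ne', ← Real.rpow_natCast (R ^ _) n,
      ← Real.rpow_mul hR0, div_mul_cancel₀ _ hn0', hcast, Real.rpow_natCast]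
    exact h5.trans_le (mul_le_mul_of_nonneg_right hMM₁ (by positivity))
  have h7 : (c : ℝ) < M₁ ^ ((n : ℝ)⁻¹) * R ^ (((N : ℝ) + 1) / n) :=
    lt_of_pow_lt_pow_left₀ n (by positivity) h6
  -- (N+1)/n ≤ 1 + ε₀ and R ≥ 1
  have h8 : ((N : ℝ) + 1) / n ≤ 1 + ε₀ := by
    rw [div_le_iff₀ (by exact_mod_cast hn0 : (0 : ℝ) < n), hN]
    push_cast
    nlinarith
  calc (c : ℝ) < M₁ ^ ((n : ℝ)⁻¹) * R ^ (((N : ℝ) + 1) / n) := h7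
    _ ≤ M₁ ^ ((n : ℝ)⁻¹) * R ^ (1 + ε₀) :=
        mul_le_mul_of_nonneg_left (Real.rpow_le_rpow_of_exponent_le hR1 h8) (by positivity)

/-! ## §3  Arithmetic helpers -/

/-- The members of an abc triple are nonzero and `a < c`, `b < c`. -/
theorem triple_facts {a b c : ℕ} (ht : IsABCTriple a b c) :
    a ≠ 0 ∧ b ≠ 0 ∧ c ≠ 0 ∧ a < c ∧ b < c := by
  obtain ⟨ha, hb, habc, _⟩ := ht
  omega

/-- `radical (m * n) ≤ radical m * radical n`. -/
private theorem radical_mul_le (m n : ℕ) : radical (m * n) ≤ radical m * radical n :=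
  Nat.le_of_dvd (Nat.mul_pos (Nat.radical_pos _) (Nat.radical_pos _)) radical_mul_dvd

/-- `radical n ≤ n` for `0 < n`. -/
theorem radical_le_self {n : ℕ} (hn : 0 < n) : radical n ≤ n := Nat.le_of_dvd hn radical_dvd_self

/-- `radical (m * n) ≤ radical m * n` for `0 < n`. -/
theorem radical_mul_le_mul_self (m : ℕ) {n : ℕ} (hn : 0 < n) : radical (m * n) ≤ radical m * n :=
  (radical_mul_le m n).trans (Nat.mul_le_mul_left _ (radical_le_self hn))

/-- For a coprime triple, `rad(abc) = rad a · rad b · rad c`. -/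
private theorem rad_eq_prod {a b c : ℕ} (ht : IsABCTriple a b c) : rad a b c = radical a * radical b * radical c := by
  obtain ⟨ha, hb, habc, hcop⟩ := ht
  have hac : Nat.Coprime a c := by rw [← habc]; exact Nat.coprime_self_add_right.mpr hcop
  have hbc : Nat.Coprime b c := by rw [← habc]; exact Nat.coprime_add_self_right.mpr hcop.symm
  rw [rad_def, radical_mul (Nat.coprime_iff_isRelPrime.mp (Nat.Coprime.mul_left hac hbc)),
    radical_mul (Nat.coprime_iff_isRelPrime.mp hcop)]

/-- Every multiplicity is admissible at the member `1`. -/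
theorem adm_one (p : ℕ) : Adm p 1 := ⟨fun _ => rfl, fun ℓ hℓ => by simp at hℓ⟩

/-- A perfect `k`-th power is `k`-full. -/
theorem adm_pow {k x : ℕ} (hk : k ≠ 0) (hx : x ≠ 0) : Adm k (x ^ k) := by
  refine ⟨fun h => absurd h hk, fun ℓ hℓ => ?_⟩
  rw [Nat.primeFactors_pow _ hk] at hℓ
  obtain ⟨hℓp, hℓx, -⟩ := Nat.mem_primeFactors.1 hℓ
  rw [Nat.factorization_pow, Finsupp.smul_apply, smul_eq_mul]
  exact Nat.le_mul_of_pos_right k (hℓp.factorization_pos_of_dvd hx hℓx)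

/-- `k`-fullness from a `k`-th power divisor carrying every prime. -/
theorem adm_of_pow_dvd {k n m : ℕ} (hk : k ≠ 0) (hm : m ≠ 0) (hdvd : n ^ k ∣ m)
    (hprimes : ∀ ℓ : ℕ, ℓ.Prime → ℓ ∣ m → ℓ ∣ n) : Adm k m := by
  refine ⟨fun h => absurd h hk, fun ℓ hℓ => ?_⟩
  obtain ⟨hℓp, hℓm, -⟩ := Nat.mem_primeFactors.1 hℓ
  have : ℓ ^ k ∣ m := (pow_dvd_pow_of_dvd (hprimes ℓ hℓp hℓm) k).trans hdvd
  exact (hℓp.pow_dvd_iff_le_factorization hm).mp this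

/-- Admissibility is downward monotone in a nonzero multiplicity: `Adm p x`, `p' ≤ p`, `p' ≠ 0` give `Adm p' x`. -/
theorem adm_mono {p p' x : ℕ} (h : Adm p x) (hp' : p' ≠ 0) (hle : p' ≤ p) : Adm p' x :=
  ⟨fun h0 => absurd h0 hp', fun ℓ hℓ => hle.trans (h.2 ℓ hℓ)⟩

/-- The prime divisors of `108 = 2² · 3³` are `2` and `3`. -/
theorem prime_dvd_108 {ℓ : ℕ} (hℓ : ℓ.Prime) (h : ℓ ∣ 108) : ℓ = 2 ∨ ℓ = 3 := by
  have h' : ℓ ∣ 2 ^ 2 * 3 ^ 3 := by norm_num at h ⊢; exact h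
  rcases (Nat.Prime.dvd_mul hℓ).mp h' with h2 | h3
  · exact Or.inl ((Nat.prime_dvd_prime_iff_eq hℓ Nat.prime_two).mp (hℓ.dvd_of_dvd_pow h2))
  · exact Or.inr ((Nat.prime_dvd_prime_iff_eq hℓ Nat.prime_three).mp (hℓ.dvd_of_dvd_pow h3))

end Summit.ABC.ABC.Theorems.PlatonicClosure
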